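import Summits.CriticalPhenomena.PercolationContinuityZ3.Theses.PercShatteringRace
import Summits.CriticalPhenomena.PercolationContinuityZ3.Theorems.PercShatteringRaceFreeSusceptibilityPowerSavingUnrootedSplit
import Literature.Probability.Percolation.SharpnessDCTProofs
import Literature.Probability.LatticeModels.ThermodynamicLimit
import HarnessLib

/-!
# Crux `PercShatteringRace.FreeSusceptibilityPowerSaving` = S(1/2) (stmt-CriticalPhenomena-5786),
# line `bk-hyperscaling-tail-transfer` — bridge stub `stub_semiRootedSplit`
# (census Dc2 at `(a₁, a₂, q) = (1/4, 1/8, 2)`): `ROOT(1/4) ∧ KMAX₂(21/4) ⟹ S(1/2)`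

Helper file of the line lead c3 (prover-line-stmt-CriticalPhenomena-5786-c3),
`--supports stmt-CriticalPhenomena-5786`; it proves the registered bridge stub `stub_semiRootedSplit`
of the checked skeleton `Cruxes/FreeSusceptibilityPowerSaving/Lines/bk_hyperscaling_tail_transfer.lean`
(§2b, `Sig.stub_semiRootedSplit`), concluding the crux BY NAME from its two antecedents.

Setting: critical bond percolation on `ℤ³` (`P = bondPercolation (zdGraph 3) (criticalProbI 3)`),
the free box `Λ_R = box 3 R`, the IN-BOX cluster `C_R(x)(ω) = {v ∈ Λ_R : x ↔ v inside Λ_R}`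
(spelled `(box 3 R).filter fun v => ω ∈ openConnIn ↑(box 3 R) x v`), the free susceptibility
`χᶠ_R = Σ_{y ∈ Λ_R} P(0 ↔ y in Λ_R) = E|C_R(0)|`, the largest in-box cluster size
`K_max(ω) = max_{x ∈ Λ_R} |C_R(x)(ω)|` (a `Finset.sup`), the threshold `N₀ = ⌈R^{5/2}⌉₊` and the
fat event `F = {N₀ ≤ |C_R(0)|}`.

* `ROOT(1/4)` (first antecedent): `P(F) ≤ C₁ R^{-1/4}` for `R ≥ 1` — the rooted content of the crux at
  ONE threshold (truth `≈ R^{-0.45}`); open, "the crux's hard core in purest form" (census Dc2).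
* `KMAX₂(21/4)` (second antecedent): `E K_max² ≤ C₂ R^{21/4}` for `R ≥ 1` (truth `≈ R^{5.05}`); open,
  the wall of stmt-CriticalPhenomena-4447 in `K_max` costume.
* Conclusion: `S(1/2) = FreeSusceptibilityPowerSaving`, `χᶠ_R ≤ C R^{5/2}`.

Proof (elementary, this file): (1) `χᶠ_R = E|C_R(0)|` (linearity; the landed sibling
`StubUnrootedSplit.sum_real_eq_integral_card` of the Dc3 file, whose measurability lemmas
`measurable_of_dependsOn` / `measurable_fun_cl` — in-box clusters depend only on the pairs of the box —
are reused here); (2) pointwise layer cake at `N₀`: `|C_R(0)| ≤ N₀ + K_max · 𝟙_F` (`|C_R(0)| ≤ K_max`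
as `0 ∈ Λ_R`); (3) integrate and Cauchy–Schwarz in `L²(P)` (`integral_mul_le_Lp_mul_Lq_of_nonneg` with
`p = q = 2`, `K_max ≤ |Λ_R|` bounded and measurable): `E[K_max 𝟙_F] ≤ (E K_max²)^{1/2} P(F)^{1/2}`;
(4) arithmetic: `N₀ ≤ R^{5/2} + 1 ≤ 2 R^{5/2}` and
`(C₂ R^{21/4})^{1/2} (C₁ R^{-1/4})^{1/2} = √C₁ √C₂ R^{21/8 - 1/8} = √C₁ √C₂ R^{5/2}`, so
`C = 2 + √(C₁⁺) √(C₂⁺)` works (`Cᵢ⁺ = max Cᵢ 0`).  As a SPLIT this Dc2 is superseded by the fully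
unrooted Dc3 (`stub_unrootedSplit`, landed), but it is recorded: both children are open and
engine-less.  No definitions, no notations.
-/

noncomputable section

namespace Summit.CriticalPhenomena.PercolationContinuityZ3.Theorems

open MeasureTheory Finset
open Literature.Probability.Percolation Literature.Probability.LatticeModels
open scoped Classical

namespace StubSemiRootedSplit

/-! ## Generic steps: Cauchy–Schwarz against an indicator, the integrated layer cake, the pointwise layer cake -/

/-- **Cauchy–Schwarz against an indicator**: for a measurable `0 ≤ f ≤ B` on a probability space and a
measurable event `F`, `E[f 𝟙_F] ≤ (E f²)^{1/2} P(F)^{1/2}` (Hölder with `p = q = 2`,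
`integral_mul_le_Lp_mul_Lq_of_nonneg`; `𝟙_F² = 𝟙_F`). [folklore] -/
theorem integral_mul_indicator_le {Ω : Type*} [MeasurableSpace Ω] (μ : Measure Ω)
    [IsProbabilityMeasure μ] {f : Ω → ℝ} (hf : Measurable f) (hf0 : ∀ ω, 0 ≤ f ω) {B : ℝ}
    (hfB : ∀ ω, f ω ≤ B) {F : Set Ω} (hF : MeasurableSet F) :
    ∫ ω, f ω * F.indicator 1 ω ∂μ
      ≤ (∫ ω, f ω ^ 2 ∂μ) ^ ((1 : ℝ) / 2) * (μ.real F) ^ ((1 : ℝ) / 2) := by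
  have hpq : (2 : ℝ).HolderConjugate 2 := Real.HolderConjugate.two_two
  have hg0 : ∀ ω, 0 ≤ F.indicator (1 : Ω → ℝ) ω :=
    fun ω => Set.indicator_nonneg (fun _ _ => zero_le_one) ω
  have hg1 : ∀ ω, F.indicator (1 : Ω → ℝ) ω ≤ 1 :=
    fun ω => Set.indicator_apply_le' (fun _ => le_rfl) (fun _ => zero_le_one)
  have hfm : MemLp f (ENNReal.ofReal 2) μ :=
    MemLp.of_bound hf.aestronglyMeasurable B
      (ae_of_all _ fun ω => by rw [Real.norm_of_nonneg (hf0 ω)]; exact hfB ω)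
  have hgm : MemLp (F.indicator (1 : Ω → ℝ)) (ENNReal.ofReal 2) μ :=
    MemLp.of_bound (measurable_const.indicator hF).aestronglyMeasurable 1
      (ae_of_all _ fun ω => by rw [Real.norm_of_nonneg (hg0 ω)]; exact hg1 ω)
  have h := integral_mul_le_Lp_mul_Lq_of_nonneg hpq (ae_of_all _ hf0) (ae_of_all _ hg0) hfm hgm
  have hf2 : ∫ ω, f ω ^ (2 : ℝ) ∂μ = ∫ ω, f ω ^ 2 ∂μ := by simp_rw [Real.rpow_two]
  have hg2 : ∫ ω, F.indicator (1 : Ω → ℝ) ω ^ (2 : ℝ) ∂μ = μ.real F := by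
    have h1 : ∀ ω, F.indicator (1 : Ω → ℝ) ω ^ (2 : ℝ) = F.indicator 1 ω := fun ω => by
      rw [Real.rpow_two]
      by_cases hω : ω ∈ F
      · rw [Set.indicator_of_mem hω, Pi.one_apply, one_pow]
      · rw [Set.indicator_of_notMem hω]; norm_num
    simp_rw [h1]
    exact integral_indicator_one hF
  rw [hf2, hg2] at h
  simpa only [one_div] using h

/-- **Layer cake + Cauchy–Schwarz, integrated**: on a probability space, if `0 ≤ c ≤ N + f 𝟙_F` pointwise
with `f` measurable, `0 ≤ f ≤ B`, and `F` measurable, then `E c ≤ N + (E f²)^{1/2} P(F)^{1/2}`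
(`c` need not be known integrable: `integral_mono_of_nonneg`). [folklore] -/
theorem integral_le_of_le_add_mul_indicator {Ω : Type*} [MeasurableSpace Ω] (μ : Measure Ω)
    [IsProbabilityMeasure μ] {c f : Ω → ℝ} (hc0 : ∀ ω, 0 ≤ c ω) (hf : Measurable f)
    (hf0 : ∀ ω, 0 ≤ f ω) {B : ℝ} (hfB : ∀ ω, f ω ≤ B) {F : Set Ω} (hF : MeasurableSet F) (N : ℝ)
    (hle : ∀ ω, c ω ≤ N + f ω * F.indicator 1 ω) :
    ∫ ω, c ω ∂μ ≤ N + (∫ ω, f ω ^ 2 ∂μ) ^ ((1 : ℝ) / 2) * (μ.real F) ^ ((1 : ℝ) / 2) := by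
  have hprod_meas : Measurable fun ω => f ω * F.indicator 1 ω :=
    hf.mul (measurable_const.indicator hF)
  have hprod_bd : ∀ ω, ‖f ω * F.indicator (1 : Ω → ℝ) ω‖ ≤ B := fun ω => by
    have hg0 : 0 ≤ F.indicator (1 : Ω → ℝ) ω := Set.indicator_nonneg (fun _ _ => zero_le_one) ω
    have hg1 : F.indicator (1 : Ω → ℝ) ω ≤ 1 :=
      Set.indicator_apply_le' (fun _ => le_rfl) (fun _ => zero_le_one)
    rw [Real.norm_of_nonneg (mul_nonneg (hf0 ω) hg0)]
    calc f ω * F.indicator 1 ω ≤ f ω * 1 := mul_le_mul_of_nonneg_left hg1 (hf0 ω)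
      _ ≤ B := by rw [mul_one]; exact hfB ω
  have hint : Integrable (fun ω => f ω * F.indicator 1 ω) μ :=
    Integrable.of_bound hprod_meas.aestronglyMeasurable B (ae_of_all _ hprod_bd)
  have hint' : Integrable (fun ω => N + f ω * F.indicator 1 ω) μ := (integrable_const N).add hint
  calc ∫ ω, c ω ∂μ ≤ ∫ ω, N + f ω * F.indicator 1 ω ∂μ :=
        integral_mono_of_nonneg (ae_of_all _ hc0) hint' (ae_of_all _ hle)
    _ = N + ∫ ω, f ω * F.indicator 1 ω ∂μ := by
        rw [integral_add (integrable_const N) hint, integral_const, probReal_univ, one_smul]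
    _ ≤ N + (∫ ω, f ω ^ 2 ∂μ) ^ ((1 : ℝ) / 2) * (μ.real F) ^ ((1 : ℝ) / 2) := by
        gcongr
        exact integral_mul_indicator_le μ hf hf0 hfB hF

/-- **Pointwise layer cake at one threshold**: for sizes `g x ω ∈ ℕ` indexed by a finite set of roots
`Λ ∋ u`, `g u ω ≤ N + (max_{x ∈ Λ} g x ω) · 𝟙[N ≤ g u ω]` (below the threshold trivially; above it
`g u ω ≤ max`, `Finset.le_sup`). [folklore] -/
theorem cast_le_add_sup_mul_indicator {Ω α : Type*} (Λ : Finset α) (g : α → Ω → ℕ) {u : α}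
    (hu : u ∈ Λ) (N : ℕ) (ω : Ω) :
    (g u ω : ℝ) ≤ N + ((Λ.sup fun x => g x ω : ℕ) : ℝ) * {ω' | N ≤ g u ω'}.indicator 1 ω := by
  by_cases h : N ≤ g u ω
  · have hmem : ω ∈ {ω' | N ≤ g u ω'} := h
    rw [Set.indicator_of_mem hmem, Pi.one_apply, mul_one]
    have hle : g u ω ≤ Λ.sup fun x => g x ω := Finset.le_sup (f := fun x => g x ω) hu
    have hle' : (g u ω : ℝ) ≤ ((Λ.sup fun x => g x ω : ℕ) : ℝ) := by exact_mod_cast hle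
    have hN0 : (0 : ℝ) ≤ N := Nat.cast_nonneg N
    linarith
  · have hnot : ω ∉ {ω' | N ≤ g u ω'} := h
    rw [Set.indicator_of_notMem hnot, mul_zero, add_zero]
    exact_mod_cast (not_le.1 h).le

/-! ## The exponent arithmetic of Dc2: `⌈R^{5/2}⌉ + (C₂ R^{21/4})^{1/2} (C₁ R^{-1/4})^{1/2} ≤ C R^{5/2}` -/

/-- **Exchange rate of the semi-rooted split** at `(a₁, a₂, q) = (1/4, 1/8, 2)`: if `0 ≤ P ≤ C₁ R^{-1/4}` and
`0 ≤ I ≤ C₂ R^{21/4}` (`R ≥ 1`), then `⌈R^{5/2}⌉₊ + I^{1/2} P^{1/2} ≤ (2 + √(C₁⁺) √(C₂⁺)) R^{5/2}`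
(`21/8 - 1/8 = 5/2`, `⌈R^{5/2}⌉₊ ≤ R^{5/2} + 1 ≤ 2 R^{5/2}`). [folklore] -/
theorem ceil_add_sqrt_mul_sqrt_le {R : ℕ} (hR : 1 ≤ R) {C₁ C₂ P I : ℝ} (hP0 : 0 ≤ P) (hI0 : 0 ≤ I)
    (hP : P ≤ C₁ * (R : ℝ) ^ (-(1 : ℝ) / 4)) (hI : I ≤ C₂ * (R : ℝ) ^ ((21 : ℝ) / 4)) :
    (⌈(R : ℝ) ^ ((5 : ℝ) / 2)⌉₊ : ℝ) + I ^ ((1 : ℝ) / 2) * P ^ ((1 : ℝ) / 2) ≤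
      (2 + (max C₁ 0) ^ ((1 : ℝ) / 2) * (max C₂ 0) ^ ((1 : ℝ) / 2)) * (R : ℝ) ^ ((5 : ℝ) / 2) := by
  have hR1 : (1 : ℝ) ≤ R := by exact_mod_cast hR
  have hR0 : (0 : ℝ) < R := by linarith
  set ρ : ℝ := (R : ℝ) ^ ((5 : ℝ) / 2) with hρ
  have hρ1 : 1 ≤ ρ := Real.one_le_rpow hR1 (by norm_num)
  have hN : (⌈ρ⌉₊ : ℝ) ≤ 2 * ρ := by
    have := (Nat.ceil_lt_add_one (by linarith : (0 : ℝ) ≤ ρ)).le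
    linarith
  have hr1 : 0 ≤ (R : ℝ) ^ (-(1 : ℝ) / 4) := Real.rpow_nonneg hR0.le _
  have hr2 : 0 ≤ (R : ℝ) ^ ((21 : ℝ) / 4) := Real.rpow_nonneg hR0.le _
  have hP' : P ≤ max C₁ 0 * (R : ℝ) ^ (-(1 : ℝ) / 4) :=
    hP.trans (mul_le_mul_of_nonneg_right (le_max_left _ _) hr1)
  have hI' : I ≤ max C₂ 0 * (R : ℝ) ^ ((21 : ℝ) / 4) :=
    hI.trans (mul_le_mul_of_nonneg_right (le_max_left _ _) hr2)
  have hc1 : 0 ≤ max C₁ 0 := le_max_right _ _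
  have hc2 : 0 ≤ max C₂ 0 := le_max_right _ _
  have hP'' : P ^ ((1 : ℝ) / 2) ≤ (max C₁ 0) ^ ((1 : ℝ) / 2) * (R : ℝ) ^ (-(1 : ℝ) / 8) := by
    calc P ^ ((1 : ℝ) / 2) ≤ (max C₁ 0 * (R : ℝ) ^ (-(1 : ℝ) / 4)) ^ ((1 : ℝ) / 2) :=
          Real.rpow_le_rpow hP0 hP' (by norm_num)
      _ = (max C₁ 0) ^ ((1 : ℝ) / 2) * ((R : ℝ) ^ (-(1 : ℝ) / 4)) ^ ((1 : ℝ) / 2) :=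
          Real.mul_rpow hc1 hr1
      _ = (max C₁ 0) ^ ((1 : ℝ) / 2) * (R : ℝ) ^ (-(1 : ℝ) / 8) := by
          rw [← Real.rpow_mul hR0.le]; norm_num
  have hI'' : I ^ ((1 : ℝ) / 2) ≤ (max C₂ 0) ^ ((1 : ℝ) / 2) * (R : ℝ) ^ ((21 : ℝ) / 8) := by
    calc I ^ ((1 : ℝ) / 2) ≤ (max C₂ 0 * (R : ℝ) ^ ((21 : ℝ) / 4)) ^ ((1 : ℝ) / 2) :=
          Real.rpow_le_rpow hI0 hI' (by norm_num)
      _ = (max C₂ 0) ^ ((1 : ℝ) / 2) * ((R : ℝ) ^ ((21 : ℝ) / 4)) ^ ((1 : ℝ) / 2) :=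
          Real.mul_rpow hc2 hr2
      _ = (max C₂ 0) ^ ((1 : ℝ) / 2) * (R : ℝ) ^ ((21 : ℝ) / 8) := by
          rw [← Real.rpow_mul hR0.le]; norm_num
  have hprod : I ^ ((1 : ℝ) / 2) * P ^ ((1 : ℝ) / 2) ≤
      (max C₁ 0) ^ ((1 : ℝ) / 2) * (max C₂ 0) ^ ((1 : ℝ) / 2) * ρ := by
    calc I ^ ((1 : ℝ) / 2) * P ^ ((1 : ℝ) / 2)
        ≤ ((max C₂ 0) ^ ((1 : ℝ) / 2) * (R : ℝ) ^ ((21 : ℝ) / 8)) *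
            ((max C₁ 0) ^ ((1 : ℝ) / 2) * (R : ℝ) ^ (-(1 : ℝ) / 8)) :=
          mul_le_mul hI'' hP'' (Real.rpow_nonneg hP0 _) (by positivity)
      _ = (max C₁ 0) ^ ((1 : ℝ) / 2) * (max C₂ 0) ^ ((1 : ℝ) / 2) *
            ((R : ℝ) ^ ((21 : ℝ) / 8) * (R : ℝ) ^ (-(1 : ℝ) / 8)) := by ring
      _ = (max C₁ 0) ^ ((1 : ℝ) / 2) * (max C₂ 0) ^ ((1 : ℝ) / 2) * ρ := by
          rw [← Real.rpow_add hR0, hρ]; norm_num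
  have hcc : 0 ≤ (max C₁ 0) ^ ((1 : ℝ) / 2) * (max C₂ 0) ^ ((1 : ℝ) / 2) := by positivity
  nlinarith [hN, hprod, hcc, hρ1]

/-! ## The semi-rooted bound on `χᶠ_R = E|C_R(0)|` (in-box clusters spelled out, as in the registered signature) -/

open StubUnrootedSplit in
/-- `ω ↦ |C_R(x)(ω)|` is measurable: it depends only on the pairs of the box
(`StubUnrootedSplit.measurable_of_dependsOn`, `cl_eq_of_inter_eq`). [folklore] -/
theorem measurable_card_cl (R : ℕ) (x : Site 3) :
    Measurable fun ω : BondConfig (Site 3) =>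
      #((box 3 R).filter fun v => ω ∈ openConnIn (↑(box 3 R) : Set (Site 3)) x v) :=
  measurable_of_dependsOn ((box 3 R).sym2) fun ω ω' hω => by simp only [cl_eq_of_inter_eq hω]

open StubUnrootedSplit in
/-- **The semi-rooted bound** (steps (1)–(3) of the file docstring): for every threshold `N`,
`χᶠ_R = Σ_{y ∈ Λ_R} P_{p_c}(0 ↔ y in Λ_R) ≤ N + (E K_max²)^{1/2} · P(N ≤ |C_R(0)|)^{1/2}`. [folklore] -/
theorem sum_real_openConnIn_le (R N : ℕ) :
    ∑ y ∈ box 3 R, (bondPercolation (zdGraph 3) (criticalProbI 3)).real (openConnIn ↑(box 3 R) 0 y) ≤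
      N + (∫ ω, (((box 3 R).sup fun x =>
              #((box 3 R).filter fun v => ω ∈ openConnIn (↑(box 3 R) : Set (Site 3)) x v) : ℕ) : ℝ) ^ 2
              ∂(bondPercolation (zdGraph 3) (criticalProbI 3))) ^ ((1 : ℝ) / 2) *
          ((bondPercolation (zdGraph 3) (criticalProbI 3)).real
              {ω | N ≤ #((box 3 R).filter fun v =>
                ω ∈ openConnIn (↑(box 3 R) : Set (Site 3)) 0 v)}) ^ ((1 : ℝ) / 2) := by
  rw [sum_real_eq_integral_card R 0]
  exact integral_le_of_le_add_mul_indicator (bondPercolation (zdGraph 3) (criticalProbI 3))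
    (c := fun ω => (#((box 3 R).filter fun v => ω ∈ openConnIn (↑(box 3 R) : Set (Site 3)) 0 v) : ℝ))
    (f := fun ω => (((box 3 R).sup fun x =>
      #((box 3 R).filter fun v => ω ∈ openConnIn (↑(box 3 R) : Set (Site 3)) x v) : ℕ) : ℝ))
    (fun ω => Nat.cast_nonneg _) (measurable_fun_cl R fun c => (box 3 R).sup fun x => #(c x))
    (fun ω => Nat.cast_nonneg _) (B := ((box 3 R).card : ℝ)) (fun ω => Nat.cast_le.2 (kmax_le_card R ω))
    (measurableSet_le measurable_const (measurable_card_cl R 0)) (N : ℝ)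
    (cast_le_add_sup_mul_indicator (box 3 R)
      (fun x ω => #((box 3 R).filter fun v => ω ∈ openConnIn (↑(box 3 R) : Set (Site 3)) x v))
      (zero_mem_box 3 R) N)

end StubSemiRootedSplit

open StubSemiRootedSplit in
/-- **Bridge stub `stub_semiRootedSplit` (census Dc2 at `(a₁, a₂, q) = (1/4, 1/8, 2)`):
`ROOT(1/4) ∧ KMAX₂(21/4) ⟹ S(1/2)`.**  If `P_{p_c}(⌈R^{5/2}⌉ ≤ |C_R(0)|) ≤ C₁ R^{-1/4}` (ROOT) and
`E_{p_c} K_max(Λ_R)² ≤ C₂ R^{21/4}` (KMAX₂, `K_max(Λ_R) = max_{x ∈ Λ_R} |C_R(x)|`, in-box clusters of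
`Λ_R = box 3 R`) for all `R ≥ 1`, then the crux `PercShatteringRace.FreeSusceptibilityPowerSaving` = S(1/2):
`Σ_{y ∈ Λ_R} P_{p_c}(0 ↔ y in Λ_R) ≤ C R^{5/2}`, with `C = 2 + √(C₁⁺) √(C₂⁺)`.  Proof: `χᶠ_R = E|C_R(0)| ≤
N₀ + E[K_max 𝟙_F] ≤ N₀ + (E K_max²)^{1/2} P(F)^{1/2}` (`N₀ = ⌈R^{5/2}⌉₊`, `F = {N₀ ≤ |C_R(0)|}`,
Cauchy–Schwarz), then `N₀ ≤ 2 R^{5/2}` and `21/8 - 1/8 = 5/2`.  Both antecedents are OPEN (census: ROOT is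
the crux's hard core at one threshold; KMAX₂ is stmt-4447's wall in `K_max` costume). [folklore] -/
theorem stub_semiRootedSplit : (∃ C : ℝ, ∀ R : ℕ, 1 ≤ R → (bondPercolation (zdGraph 3) (criticalProbI 3)).real {ω | ⌈(R : ℝ) ^ ((5 : ℝ) / 2)⌉₊ ≤ ((box 3 R).filter fun v => ω ∈ openConnIn ↑(box 3 R) 0 v).card} ≤ C * (R : ℝ) ^ (-(1 : ℝ) / 4)) → (∃ C : ℝ, ∀ R : ℕ, 1 ≤ R → ∫ ω, (((box 3 R).sup fun x => ((box 3 R).filter fun v => ω ∈ openConnIn ↑(box 3 R) x v).card : ℕ) : ℝ) ^ 2 ∂(bondPercolation (zdGraph 3) (criticalProbI 3)) ≤ C * (R : ℝ) ^ ((21 : ℝ) / 4)) → Summit.CriticalPhenomena.PercolationContinuityZ3.Theses.PercShatteringRace.FreeSusceptibilityPowerSaving := by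
  rintro ⟨C₁, hC₁⟩ ⟨C₂, hC₂⟩
  refine ⟨2 + (max C₁ 0) ^ ((1 : ℝ) / 2) * (max C₂ 0) ^ ((1 : ℝ) / 2), fun R hR => ?_⟩
  exact (sum_real_openConnIn_le R ⌈(R : ℝ) ^ ((5 : ℝ) / 2)⌉₊).trans
    (ceil_add_sqrt_mul_sqrt_le hR measureReal_nonneg (integral_nonneg fun ω => sq_nonneg _)
      (hC₁ R hR) (hC₂ R hR))

end Summit.CriticalPhenomena.PercolationContinuityZ3.Theorems

end
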